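import Summits.QuantumAdvantage.QuantumAdvantage.Theorems.CubicForrelationNearExactIsExactKtGapAll

/-!
# Crux `CubicForrelation.NearExactIsExact` (stmt-QuantumAdvantage-14043) — the Kasami–Tokura gap `(1.5d, 1.75d)` for EVERY order, I: tools

Certificate seat `b2b-cforr-cert` (gen 45).  HONEST FRAMING: coding-theory TOOLS (standard axioms, uniform in the number of bits `m` AND in the
order `r`) for the brick "no Boolean function of degree `≤ r` (`r ≥ 2`) on `m` bits has weight strictly between `1.5·2^{m-r}` and `1.75·2^{m-r}`"
(`…KtGapOrder.lean`; the tree had the order-3 case only, `kt_gap_cubic`).  NOT summit progress.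

* `kto_deriv_card`: `#{x : c x ≠ c(x ⊕ a)} + 2·#(E ∩ (E ⊕ a)) = 2·#E` (`E = {c = 1}`);
* `kto_deriv_values`: for `c` of degree `≤ r + 1` with `2^{r+3}·#E < 7·2^m`, GIVEN the gap for order `r` on `m` bits, every derivative
  intersection `I(a) = #(E ∩ (E ⊕ a))` is `#E − 1.5d`, `#E − d` or `#E` (`d = 2^{m-r-1}`): the derivative `c ⊕ c(·⊕a)` has degree `≤ r`
  and `2(#E − I(a)) < 1.75·2^{m-r}` ones, so its weight is `0`, `2^{m-r}` (second weight, `sw_second_weight_all`) or `1.5·2^{m-r}` (the gap);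
* `kto_sq_dvd`: hence `2^m ∣ 2^{r+2}·#E²` (`Σ_a I(a) = #E²`);
* `kto_gap_two`: the order-2 base case, from the plateaued spectrum of a quadratic (`stub_quadWalshPlateau`): `2^m − 2#E ∈ (2^{m-3}, 2^{m-2})`
  is not `0` or `± 2^s`.

References: T. Kasami, N. Tokura, IEEE Trans. IT 16 (1970) 752–759, Thm 1; MacWilliams–Sloane (1977) Ch. 15 §3.  Axioms: the standard three.
-/

set_option linter.dupNamespace false -- D-0017: single-problem summit ⇒ `QuantumAdvantage.QuantumAdvantage` by design

noncomputable section

namespace Summit.QuantumAdvantage.QuantumAdvantage.Theorems.CubicForrelation.NearExactIsExact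

open Finset
open Literature.Computability.QuantumComplexity
open Literature.Computability.QuantumComplexity.BuzetChailloux (bxor zeroVec bxor_bxor_cancel_left bxor_zeroVec zeroVec_bxor bxor_comm
  bxor_self twist_zeroVec_right twist_bxor_right)
open Literature.Computability.QuantumComplexity.DerivativeWalsh (W twist_bxor_left)

/-! ### Derivative weights versus derivative intersections -/

/-- **Derivative weight = twice the defect of the intersection**: `#{x : c x ≠ c(x ⊕ a)} + 2·#(E ∩ (E ⊕ a)) = 2·#E` for `E = {c = 1}`
(the derivative support is `{x ∈ E : x ⊕ a ∉ E} ⊔ {x ∉ E : x ⊕ a ∈ E}`, two sets of the same size). [folklore] -/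
theorem kto_deriv_card {m : ℕ} (c : (Fin m → Bool) → Bool) (a : Fin m → Bool) :
    #(univ.filter fun x => (c x ^^ c (bxor x a)) = true) +
        2 * #((univ.filter fun x => c x = true).filter fun x => bxor x a ∈ univ.filter fun x => c x = true) =
      2 * #(univ.filter fun x => c x = true) := by
  classical
  set S := univ.filter (fun x : Fin m → Bool => c x = true) with hSdef
  have hmemS : ∀ x, x ∈ S ↔ c x = true := fun x => by simp [hSdef]
  have hcancel : ∀ x : Fin m → Bool, bxor (bxor x a) a = x := fun x => by rw [iw_bxor_assoc, bxor_self, bxor_zeroVec]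
  -- split the derivative support by the value of `c x`
  have hsplit : #(univ.filter fun x => (c x ^^ c (bxor x a)) = true) =
      #(S.filter fun x => bxor x a ∉ S) + #((univ.filter fun x : Fin m → Bool => c x = false).filter fun x => bxor x a ∈ S) := by
    rw [← card_union_of_disjoint]
    · congr 1
      ext x
      simp only [mem_filter, mem_union, mem_univ, true_and, hmemS]
      cases c x <;> cases c (bxor x a) <;> simp
    · exact disjoint_left.2 fun {x} h1 h2 => by
        have e1 : c x = true := (hmemS x).1 (mem_filter.1 h1).1
        have e2 : c x = false := (mem_filter.1 (mem_filter.1 h2).1).2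
        rw [e1] at e2
        exact Bool.noConfusion e2
  -- the two parts have the same size (`x ↦ x ⊕ a`)
  have hflip : #((univ.filter fun x : Fin m → Bool => c x = false).filter fun x => bxor x a ∈ S) =
      #(S.filter fun x => bxor x a ∉ S) := by
    refine card_nbij' (fun x => bxor x a) (fun x => bxor x a) (fun x hx => ?_) (fun x hx => ?_)
      (fun x _ => hcancel x) (fun x _ => hcancel x)
    · rw [mem_coe, mem_filter, mem_filter] at hx
      rw [mem_coe, mem_filter, hcancel]
      refine ⟨hx.2, fun h => ?_⟩
      rw [hmemS, hx.1.2] at h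
      exact Bool.noConfusion h
    · rw [mem_coe, mem_filter] at hx
      rw [mem_coe, mem_filter, mem_filter, hcancel]
      refine ⟨⟨mem_univ _, ?_⟩, hx.1⟩
      have h2 : ¬ c (bxor x a) = true := fun h => hx.2 ((hmemS _).2 h)
      simpa using h2
  have hpart : #(S.filter fun x => bxor x a ∉ S) + #(S.filter fun x => bxor x a ∈ S) = #S := by
    rw [add_comm]; exact card_filter_add_card_filter_not _
  omega

/-! ### Derivative intersections below `1.75 d`, every order -/

/-- **Derivative intersections, order `r + 1` (`r ≥ 2`).**  Assume the Kasami–Tokura gap for order `r` on `m` bits (no function of degree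
`≤ r` has `3·2^m < 2^{r+1}·#E' ∧ 2^{r+2}·#E' < 7·2^m`).  Then for `c` of degree `≤ r + 1` on `m` bits with `2^{r+3}·#E < 7·2^m`,
`E = {c = 1}`, and any `a`: `2^{r+2}·#(E ∩ (E ⊕ a)) + 3·2^m = 2^{r+2}·#E`, or `2^{r+1}·#(E ∩ (E ⊕ a)) + 2^m = 2^{r+1}·#E`, or
`#(E ∩ (E ⊕ a)) = #E` (the derivative along `a` has degree `≤ r` and fewer than `1.75·2^{m-r}` ones: its weight is `0`, `2^{m-r}` by the
second weight `sw_second_weight_all`, or `1.5·2^{m-r}` by the assumed gap). [this work; Kasami–Tokura bookkeeping] -/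
theorem kto_deriv_values {m r : ℕ} (hr : 2 ≤ r)
    (hgap : ∀ e : (Fin m → Bool) → Bool, IsDegLeFun r e →
      ¬ (3 * 2 ^ m < 2 ^ (r + 1) * #(univ.filter fun x => e x = true) ∧ 2 ^ (r + 2) * #(univ.filter fun x => e x = true) < 7 * 2 ^ m))
    (c : (Fin m → Bool) → Bool) (hc : IsDegLeFun (r + 1) c)
    (h2 : 2 ^ (r + 3) * #(univ.filter fun x => c x = true) < 7 * 2 ^ m) (a : Fin m → Bool) :
    2 ^ (r + 2) * #((univ.filter fun x => c x = true).filter fun x => bxor x a ∈ univ.filter fun x => c x = true) + 3 * 2 ^ m =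
        2 ^ (r + 2) * #(univ.filter fun x => c x = true) ∨
      2 ^ (r + 1) * #((univ.filter fun x => c x = true).filter fun x => bxor x a ∈ univ.filter fun x => c x = true) + 2 ^ m =
        2 ^ (r + 1) * #(univ.filter fun x => c x = true) ∨
      #((univ.filter fun x => c x = true).filter fun x => bxor x a ∈ univ.filter fun x => c x = true) =
        #(univ.filter fun x => c x = true) := by
  classical
  set S := univ.filter (fun x : Fin m → Bool => c x = true) with hSdef
  set I := #(S.filter fun x => bxor x a ∈ S) with hIdef
  set D := #(univ.filter fun x => (c x ^^ c (bxor x a)) = true) with hDdef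
  have hD : D + 2 * I = 2 * #S := kto_deriv_card c a
  have hdeg : IsDegLeFun r (fun x => c x ^^ c (bxor x a)) := stub_derivDegree m r c a hc
  by_cases hD0 : D = 0
  · right; right; omega
  have hne : ∃ x, (c x ^^ c (bxor x a)) = true := by
    by_contra hn
    push Not at hn
    exact hD0 (card_eq_zero.2 (filter_eq_empty_iff.2 fun y _ => hn y))
  have h83 : (2 : ℕ) ^ (r + 3) = 2 ^ (r + 2) * 2 := by ring
  have h82 : (2 : ℕ) ^ (r + 2) = 2 ^ (r + 1) * 2 := by ring
  by_cases hlt : 2 ^ (r + 1) * D < 3 * 2 ^ m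
  · -- second weight: `2^r · D = 2^m`
    right; left
    have hsw : 2 ^ r * D = 2 ^ m := sw_second_weight_all r hr m _ hdeg hne hlt
    have e1 : ((D : ℕ) : ℤ) + 2 * I = 2 * #S := by exact_mod_cast hD
    have e2 : (2 : ℤ) ^ r * D = 2 ^ m := by exact_mod_cast hsw
    have e : (2 : ℤ) ^ (r + 1) * I + 2 ^ m = 2 ^ (r + 1) * #S := by linear_combination (2 : ℤ) ^ r * e1 - e2
    exact_mod_cast e
  · -- the gap: `2^{r+1} · D = 3·2^m`
    left
    push Not at hlt
    have hDle : D ≤ 2 * #S := by omega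
    have hle2 : 2 ^ (r + 2) * D ≤ 2 ^ (r + 3) * #S :=
      calc 2 ^ (r + 2) * D ≤ 2 ^ (r + 2) * (2 * #S) := Nat.mul_le_mul_left _ hDle
        _ = 2 ^ (r + 3) * #S := by rw [h83]; ring
    have hlt2 : 2 ^ (r + 2) * D < 7 * 2 ^ m := lt_of_le_of_lt hle2 h2
    have heq : 2 ^ (r + 1) * D = 3 * 2 ^ m := by
      have hg := hgap _ hdeg
      rw [← hDdef] at hg
      have hle : ¬ 3 * 2 ^ m < 2 ^ (r + 1) * D := fun h => hg ⟨h, hlt2⟩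
      exact le_antisymm (not_lt.1 hle) hlt
    have e1 : ((D : ℕ) : ℤ) + 2 * I = 2 * #S := by exact_mod_cast hD
    have e2 : (2 : ℤ) ^ (r + 1) * D = 3 * 2 ^ m := by exact_mod_cast heq
    have e : (2 : ℤ) ^ (r + 2) * I + 3 * 2 ^ m = 2 ^ (r + 2) * #S := by linear_combination (2 : ℤ) ^ (r + 1) * e1 - e2
    exact_mod_cast e

/-- **`2^m ∣ 2^{r+2}·#E²`** for a support `E` of degree `≤ r + 1` on `m` bits with `2^{r+3}·#E < 7·2^m`, given the gap for order `r`
(`kto_deriv_values` mod `2^m`, summed over `a` with `Σ_a I(a) = #E²`). [this work] -/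
theorem kto_sq_dvd {m r : ℕ} (hr : 2 ≤ r)
    (hgap : ∀ e : (Fin m → Bool) → Bool, IsDegLeFun r e →
      ¬ (3 * 2 ^ m < 2 ^ (r + 1) * #(univ.filter fun x => e x = true) ∧ 2 ^ (r + 2) * #(univ.filter fun x => e x = true) < 7 * 2 ^ m))
    (c : (Fin m → Bool) → Bool) (hc : IsDegLeFun (r + 1) c)
    (h2 : 2 ^ (r + 3) * #(univ.filter fun x => c x = true) < 7 * 2 ^ m) :
    2 ^ m ∣ 2 ^ (r + 2) * (#(univ.filter fun x => c x = true) * #(univ.filter fun x => c x = true)) := by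
  classical
  set S := univ.filter (fun x : Fin m → Bool => c x = true) with hSdef
  have h82 : (2 : ℕ) ^ (r + 2) = 2 * 2 ^ (r + 1) := by ring
  have hq : ∀ a, ∃ q : ℕ, 2 ^ (r + 2) * #(S.filter fun x => bxor x a ∈ S) + q * 2 ^ m = 2 ^ (r + 2) * #S := by
    intro a
    rcases kto_deriv_values hr hgap c hc h2 a with h | h | h
    · exact ⟨3, h⟩
    · refine ⟨2, ?_⟩
      change 2 ^ (r + 1) * #(S.filter fun x => bxor x a ∈ S) + 2 ^ m = 2 ^ (r + 1) * #S at h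
      calc 2 ^ (r + 2) * #(S.filter fun x => bxor x a ∈ S) + 2 * 2 ^ m
          = 2 * (2 ^ (r + 1) * #(S.filter fun x => bxor x a ∈ S) + 2 ^ m) := by rw [h82]; ring
        _ = 2 * (2 ^ (r + 1) * #S) := by rw [h]
        _ = 2 ^ (r + 2) * #S := by rw [h82]; ring
    · refine ⟨0, ?_⟩
      change #(S.filter fun x => bxor x a ∈ S) = #S at h
      rw [h]; ring
  choose q hq using hq
  have hsum : 2 ^ (r + 2) * (#S * #S) + (∑ a, q a) * 2 ^ m = 2 ^ m * (2 ^ (r + 2) * #S) := by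
    rw [← ktg_sum_I S, mul_sum, sum_mul, ← sum_add_distrib, sum_congr rfl fun a _ => hq a, sum_const, card_univ,
      Fintype.card_fun, Fintype.card_bool, Fintype.card_fin, smul_eq_mul]
  have hdvd : 2 ^ m ∣ 2 ^ (r + 2) * (#S * #S) + (∑ a, q a) * 2 ^ m := by rw [hsum]; exact dvd_mul_right _ _
  exact (Nat.dvd_add_left (dvd_mul_left _ _)).1 hdvd

/-! ### The base case: order 2 -/

/-- **The gap for quadratics.**  No Boolean function of degree `≤ 2` on `m` bits has `3·2^m < 8·#E` and `16·#E < 7·2^m`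
(`E = {q = 1}`): the Walsh value `2^m − 2#E` at `0` would lie strictly between `2^{m-3}` and `2^{m-2}`, but quadratic spectra are
plateaued (`stub_quadWalshPlateau`: `W(0) ∈ {0, ± 2^s}`). [this work; Dickson / Kasami–Tokura for `r = 2`] -/
theorem kto_gap_two (m : ℕ) (q : (Fin m → Bool) → Bool) (hq : IsDegLeFun 2 q) :
    ¬ (3 * 2 ^ m < 2 ^ (2 + 1) * #(univ.filter fun x => q x = true) ∧ 2 ^ (2 + 2) * #(univ.filter fun x => q x = true) < 7 * 2 ^ m) := by
  classical
  rintro ⟨h1, h2⟩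
  norm_num at h1 h2
  -- `m ≥ 3`
  rcases Nat.lt_or_ge m 3 with hm | hm
  · interval_cases m <;> norm_num at h1 h2 <;> omega
  obtain ⟨j, rfl⟩ : ∃ j, m = j + 3 := ⟨m - 3, by omega⟩
  have hN : (2 : ℝ) ^ (j + 3) = 8 * 2 ^ j := by ring
  have hN' : (2 : ℕ) ^ (j + 3) = 8 * 2 ^ j := by ring
  rw [hN'] at h1 h2
  -- `W(0) = 2^m − 2·#S`
  have hW0 : W (fun x => signOf (q x)) zeroVec = (2 : ℝ) ^ (j + 3) - 2 * (#(univ.filter fun x => q x = true) : ℝ) := by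
    unfold W
    simp_rw [twist_zeroVec_right, mul_one]
    have e : ∀ x, signOf (q x) = 1 - 2 * (if q x = true then (1 : ℝ) else 0) := fun x => by
      cases q x <;> norm_num [signOf]
    rw [sum_congr rfl fun x _ => e x, sum_sub_distrib, ← mul_sum, sum_boole, sum_const, card_univ, Fintype.card_fun,
      Fintype.card_bool, Fintype.card_fin]
    norm_num
  obtain ⟨s, hs⟩ := stub_quadWalshPlateau (j + 3) q hq
  have hS1 : 3 * (2 : ℝ) ^ j < #(univ.filter fun x => q x = true) := by
    exact_mod_cast (show 3 * 2 ^ j < #(univ.filter fun x => q x = true) by omega)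
  have hS2 : 2 * (#(univ.filter fun x => q x = true) : ℝ) < 7 * 2 ^ j := by
    exact_mod_cast (show 2 * #(univ.filter fun x => q x = true) < 7 * 2 ^ j by omega)
  rcases hs zeroVec with h0 | hsq
  · rw [hW0, hN] at h0
    linarith
  · rw [hW0] at hsq
    have h4 : (4 : ℝ) ^ s = ((2 : ℝ) ^ s) ^ 2 := by
      rw [show (4 : ℝ) = 2 ^ 2 by norm_num, ← pow_mul, mul_comm, pow_mul]
    rw [h4] at hsq
    have hpos : (0 : ℝ) ≤ 2 ^ (j + 3) - 2 * (#(univ.filter fun x => q x = true) : ℝ) := by rw [hN]; linarith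
    have h2s : 2 ^ (j + 3) - 2 * (#(univ.filter fun x => q x = true) : ℝ) = (2 : ℝ) ^ s :=
      (pow_left_inj₀ hpos (by positivity) (by norm_num : (2 : ℕ) ≠ 0)).1 hsq
    rw [hN] at h2s
    -- `2^j < 2^s < 2^{j+1}`
    have hlo : (2 : ℝ) ^ j < 2 ^ s := by rw [← h2s]; linarith
    have hhi : (2 : ℝ) ^ s < 2 ^ (j + 1) := by rw [← h2s, pow_succ]; linarith
    have hlo' : j < s := (pow_lt_pow_iff_right₀ (by norm_num : (1 : ℝ) < 2)).1 hlo
    have hhi' : s < j + 1 := (pow_lt_pow_iff_right₀ (by norm_num : (1 : ℝ) < 2)).1 hhi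
    omega

end Summit.QuantumAdvantage.QuantumAdvantage.Theorems.CubicForrelation.NearExactIsExact

end
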